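import Summits.Parity.GeneralizedHardyLittlewood.Theorems.CellParityLawSaving.Negative.CornerSqueeze
import HarnessLib

/-!
# Crux `CellParityLawSaving` (stmt-Parity-18104): the purely RELATIVE retyping is false (negative lemma)

Negative-side support from the crux disprover (cdisprove seat, cycle 1), third file.  The crux types a purely
ABSOLUTE allowance `N/((log N)^t (log N)^δ)`; the route's kill criteria call it "typing-fragile" and the crux
ideation (ideator 1, F1) recommends a two-tier RELATIVE retyping.  This file settles the extreme case, sorry-free:
with NO absolute floor, a relative allowance `(log N)^{-δ} · |W_θ(j) · M_j|` is FALSE.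

* `slowDegree_eq_of_mem` — the schedule pinned: `U(N) = U` for `exp exp 4U² ≤ N < exp exp 4(U+1)²` (`U ≥ 4`).
* `exists_shifted_top_value` — for every `N₀` a scale `N ≥ N₀` of the form `N = p^{U(N)} − 1`, `p` prime,
  `N^{1/U(N)} < p` (Bertrand above `⌈X^{1/U}⌉`, `X = ⌈exp exp 4U²⌉`, `U = max 4 N₀`; the step of the schedule is
  long enough to contain `[X, 2·4^U X)`).
* `cellParityLawSaving_false_relative` — at such a scale the shifted form `ψ(n) = n + (N + 1)` (`‖Ψ‖_N ≤ 3`) on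
  `K = [-N, N]` has its TOP cell `j = U(N)` inhabited (`n = 0 ↦ p^{U(N)}`), while the model
  `β_∞ 𝔖 A_{U(N)}(N)/N` vanishes (`cell_top_eq_zero`, file `CornerSqueeze`): a relative allowance demands `C_j = 0`.

Moral for the planner: keep the absolute allowance (as typed), or give any relative clause an absolute floor, or
restrict it to `j_i ≤ U(N) − 1`.  This file does NOT refute the crux. [folklore]
-/

noncomputable section

namespace Summit.Parity.GeneralizedHardyLittlewood.Theorems.CellParityLawSaving.Negative

open scoped BigOperators Classical
open Filter MeasureTheory Finset Literature.NumberTheory.Sieve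
open Summit.Parity.GeneralizedHardyLittlewood.Cruxes.FibreHyperbolicity.ModelTransfer (jointCell)
open Summit.Parity.GeneralizedHardyLittlewood.Cruxes.AbsoluteUpgrade.DipMarginRateExchange
  (slowDegree four_le_slowDegree)
open Summit.Parity.GeneralizedHardyLittlewood.Theorems.ModelHyperbolicity.Negative (cell)

/-- The schedule pinned: `exp(exp(4U²)) ≤ N < exp(exp(4(U+1)²))`, `U ≥ 4` ⟹ `U(N) = U`. [folklore] -/
theorem slowDegree_eq_of_mem {U N : ℕ} (hU : 4 ≤ U) (h1 : Real.exp (Real.exp (4 * (U : ℝ) ^ 2)) ≤ N)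
    (h2 : (N : ℝ) < Real.exp (Real.exp (4 * ((U : ℝ) + 1) ^ 2))) : slowDegree N = U := by
  have hNpos : (0 : ℝ) < N := (Real.exp_pos _).trans_le h1
  have hlog1 : Real.exp (4 * (U : ℝ) ^ 2) ≤ Real.log N := by
    rw [Real.le_log_iff_exp_le hNpos]; exact h1
  have hlogpos : 0 < Real.log N := (Real.exp_pos _).trans_le hlog1
  have hll1 : 4 * (U : ℝ) ^ 2 ≤ Real.log (Real.log N) := by
    rw [Real.le_log_iff_exp_le hlogpos]; exact hlog1
  have hlog2 : Real.log N < Real.exp (4 * ((U : ℝ) + 1) ^ 2) := by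
    rw [Real.log_lt_iff_lt_exp hNpos]; exact h2
  have hll2 : Real.log (Real.log N) < 4 * ((U : ℝ) + 1) ^ 2 := by
    rw [Real.log_lt_iff_lt_exp hlogpos]; exact hlog2
  have hll0 : 0 ≤ Real.log (Real.log N) := le_trans (by positivity) hll1
  have hs1 : (U : ℝ) ≤ Real.sqrt (Real.log (Real.log N)) / 2 := by
    rw [le_div_iff₀ (by norm_num : (0 : ℝ) < 2), Real.le_sqrt (by positivity) hll0]
    nlinarith
  have hs2 : Real.sqrt (Real.log (Real.log N)) / 2 < (U : ℝ) + 1 := by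
    rw [div_lt_iff₀ (by norm_num : (0 : ℝ) < 2), Real.sqrt_lt' (by positivity)]
    nlinarith
  have hfloor : ⌊Real.sqrt (Real.log (Real.log N)) / 2⌋₊ = U := by
    rw [Nat.floor_eq_iff (by positivity)]
    exact ⟨hs1, hs2⟩
  unfold slowDegree
  rw [hfloor, max_eq_right hU]

/-- **A shifted top cell is inhabited at arbitrarily large scales.** For every `N₀` there is `N ≥ N₀` (`N ≥ 3`)
and a prime `p` with `N^{1/U(N)} < p` and `p^{U(N)} = N + 1`: take `U = max 4 N₀`, `X = ⌈exp exp 4U²⌉`,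
a Bertrand prime `p ∈ (⌈X^{1/U}⌉, 2⌈X^{1/U}⌉]`, `N = p^U − 1 ∈ [X, 2·4^U X) ⊆ [exp exp 4U², exp exp 4(U+1)²)`.
[folklore] -/
theorem exists_shifted_top_value (N₀ : ℕ) : ∃ N : ℕ, N₀ ≤ N ∧ 3 ≤ N ∧ ∃ p : ℕ, p.Prime ∧
    (N : ℝ) ^ ((1 : ℝ) / (slowDegree N : ℕ)) < p ∧ p ^ slowDegree N = N + 1 := by
  set U : ℕ := max 4 N₀ with hUdef
  have hU4 : 4 ≤ U := le_max_left _ _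
  have hUN₀ : N₀ ≤ U := le_max_right _ _
  have hU0 : U ≠ 0 := by omega
  have hUr : (4 : ℝ) ≤ U := by exact_mod_cast hU4
  set Y : ℝ := Real.exp (Real.exp (4 * (U : ℝ) ^ 2)) with hYdef
  have hYpos : 0 < Y := Real.exp_pos _
  have hY1 : 1 ≤ Y := by
    rw [hYdef]; exact Real.one_le_exp (Real.exp_pos _).le
  set X : ℕ := ⌈Y⌉₊ with hXdef
  have hXY : Y ≤ X := Nat.le_ceil Y
  have hX1 : (1 : ℝ) ≤ X := hY1.trans hXY
  have hXpos : (0 : ℝ) < X := by linarith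
  have hXle : (X : ℝ) ≤ Y + 1 := (Nat.ceil_lt_add_one hYpos.le).le
  -- the root and a Bertrand prime above it
  set r : ℝ := (X : ℝ) ^ ((1 : ℝ) / (U : ℕ)) with hrdef
  have hr1 : 1 ≤ r := Real.one_le_rpow hX1 (by positivity)
  set q : ℕ := ⌈r⌉₊ with hqdef
  have hq0 : q ≠ 0 := by
    have : 0 < q := Nat.ceil_pos.mpr (by linarith)
    omega
  have hrq : r ≤ q := Nat.le_ceil r
  have hqle : (q : ℝ) ≤ r + 1 := (Nat.ceil_lt_add_one (by linarith)).le
  obtain ⟨p, hp, hqp, hp2q⟩ := Nat.exists_prime_lt_and_le_two_mul q hq0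
  have hrp : r < p := hrq.trans_lt (by exact_mod_cast hqp)
  have hp4r : (p : ℝ) ≤ 4 * r := by
    have : (p : ℝ) ≤ 2 * q := by exact_mod_cast hp2q
    linarith
  -- `X < p^U ≤ 4^U X`
  have hrU : r ^ U = X := by
    rw [hrdef, one_div]; exact Real.rpow_inv_natCast_pow hXpos.le hU0
  have hXlt : (X : ℝ) < (p : ℝ) ^ U := by
    rw [← hrU]; exact pow_lt_pow_left₀ hrp (by linarith) hU0
  have hpUle : (p : ℝ) ^ U ≤ (4 : ℝ) ^ U * X := by
    rw [← hrU, ← mul_pow]; exact pow_le_pow_left₀ (by positivity) hp4r U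
  have hXltN : X < p ^ U := by exact_mod_cast hXlt
  set N : ℕ := p ^ U - 1 with hNdef
  have hNp : p ^ U = N + 1 := by
    have : 1 ≤ p ^ U := Nat.one_le_pow _ _ hp.pos
    omega
  have hXN : X ≤ N := by omega
  have hNr : (X : ℝ) ≤ N := by exact_mod_cast hXN
  have hN1 : Y ≤ N := hXY.trans hNr
  -- the upper end of the step: `N < 4^U (Y + 1) ≤ 2 · 4^U · Y < exp exp 4(U+1)²`
  have hN2 : (N : ℝ) < Real.exp (Real.exp (4 * ((U : ℝ) + 1) ^ 2)) := by
    have hNlt : (N : ℝ) < (4 : ℝ) ^ U * (Y + 1) := by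
      have h1 : (N : ℝ) < (p : ℝ) ^ U := by
        have : (N : ℝ) + 1 = (p : ℝ) ^ U := by exact_mod_cast hNp.symm
        linarith
      calc (N : ℝ) < (p : ℝ) ^ U := h1
        _ ≤ (4 : ℝ) ^ U * X := hpUle
        _ ≤ (4 : ℝ) ^ U * (Y + 1) := by gcongr
    refine hNlt.trans_le ?_
    -- `4^U (Y+1) ≤ 2·4^U·Y = exp(U log 4 + log 2 + exp(4U²)) ≤ exp(exp(4(U+1)²))`
    have h2Y : (4 : ℝ) ^ U * (Y + 1) ≤ 2 * (4 : ℝ) ^ U * Y := by nlinarith [pow_pos (show (0:ℝ) < 4 by norm_num) U]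
    refine h2Y.trans ?_
    have hexp : 2 * (4 : ℝ) ^ U * Y = Real.exp (Real.log 2 + U * Real.log 4 + Real.exp (4 * (U : ℝ) ^ 2)) := by
      rw [Real.exp_add, Real.exp_add, Real.exp_log (by norm_num), ← Real.rpow_natCast,
        Real.rpow_def_of_pos (by norm_num), hYdef]
      ring_nf
    rw [hexp, Real.exp_le_exp]
    -- `log 2 + U log 4 + e^{4U²} ≤ e^{4(U+1)²} = e^{4U²} e^{8U+4}`, and `e^{8U+4} ≥ 8U + 5`
    have hl2 : Real.log 2 ≤ 1 := by
      have := Real.log_le_sub_one_of_pos (show (0:ℝ) < 2 by norm_num); linarith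
    have hl4 : Real.log 4 ≤ 3 := by
      have := Real.log_le_sub_one_of_pos (show (0:ℝ) < 4 by norm_num); linarith
    have hE1 : 1 ≤ Real.exp (4 * (U : ℝ) ^ 2) := Real.one_le_exp (by positivity)
    have hsplit : Real.exp (4 * ((U : ℝ) + 1) ^ 2) = Real.exp (4 * (U : ℝ) ^ 2) * Real.exp (8 * U + 4) := by
      rw [← Real.exp_add]; ring_nf
    have hE2 : 8 * (U : ℝ) + 4 + 1 ≤ Real.exp (8 * U + 4) := Real.add_one_le_exp _
    rw [hsplit]
    have hU0' : (0 : ℝ) ≤ U := Nat.cast_nonneg U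
    nlinarith [mul_le_mul_of_nonneg_left hE2 (le_trans zero_le_one hE1), mul_nonneg hU0' (sub_nonneg.mpr hE1)]
  refine ⟨N, ?_, ?_, p, hp, ?_, ?_⟩
  · -- `N₀ ≤ U ≤ 4U² ≤ e^{4U²} ≤ e^{e^{4U²}} = Y ≤ N`
    have h1 : (U : ℝ) ≤ 4 * (U : ℝ) ^ 2 := by nlinarith
    have h2 : 4 * (U : ℝ) ^ 2 ≤ Real.exp (4 * (U : ℝ) ^ 2) := by linarith [Real.add_one_le_exp (4 * (U : ℝ) ^ 2)]
    have h3 : Real.exp (4 * (U : ℝ) ^ 2) ≤ Y := by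
      rw [hYdef]; linarith [Real.add_one_le_exp (Real.exp (4 * (U : ℝ) ^ 2))]
    have : (N₀ : ℝ) ≤ N := by
      have h0 : (N₀ : ℝ) ≤ U := by exact_mod_cast hUN₀
      linarith
    exact_mod_cast this
  · -- `3 ≤ 4 ≤ U ≤ N`
    have : (U : ℝ) ≤ N := by
      have h1 : (U : ℝ) ≤ 4 * (U : ℝ) ^ 2 := by nlinarith
      have h2 : 4 * (U : ℝ) ^ 2 ≤ Real.exp (4 * (U : ℝ) ^ 2) := by linarith [Real.add_one_le_exp (4 * (U : ℝ) ^ 2)]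
      have h3 : Real.exp (4 * (U : ℝ) ^ 2) ≤ Y := by
        rw [hYdef]; linarith [Real.add_one_le_exp (Real.exp (4 * (U : ℝ) ^ 2))]
      linarith
    have : U ≤ N := by exact_mod_cast this
    omega
  · rw [slowDegree_eq_of_mem hU4 hN1 hN2]
    -- `N < p^U` ⟹ `N^{1/U} < p`
    have h1 : (N : ℝ) < (p : ℝ) ^ U := by
      have : (N : ℝ) + 1 = (p : ℝ) ^ U := by exact_mod_cast hNp.symm
      linarith
    have h2 : ((N : ℝ) ^ ((1 : ℝ) / (U : ℕ))) ^ U < (p : ℝ) ^ U := by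
      rw [one_div, Real.rpow_inv_natCast_pow (Nat.cast_nonneg N) hU0]; exact h1
    exact lt_of_pow_lt_pow_left₀ U (Nat.cast_nonneg p) h2
  · rw [slowDegree_eq_of_mem hU4 hN1 hN2]; exact hNp

/-- `ψ(n) = n + (N+1)` is non-degenerate. [folklore] -/
theorem isNondegenerateSystem_shiftTop (N : ℕ) : IsNondegenerateSystem (fun _ : Fin 1 => (⟨fun _ => 1, (N : ℤ) + 1⟩ : AffLinForm 1)) := by
  refine ⟨fun i h0 => ?_, fun i j hij => absurd (Subsingleton.elim i j) hij⟩
  have := congr_fun h0 0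
  simp at this

/-- `‖(n + (N+1))‖_N = 1 + (N+1)/N ≤ 3` for `N ≥ 1`. [folklore] -/
theorem affLinSize_shiftTop {N : ℕ} (hN : 1 ≤ N) :
    affLinSize (fun _ : Fin 1 => (⟨fun _ => 1, (N : ℤ) + 1⟩ : AffLinForm 1)) N ≤ ((3 : ℕ) : ℝ) := by
  have hN' : (1 : ℝ) ≤ N := by exact_mod_cast hN
  have hNpos : (0 : ℝ) < N := by linarith
  simp only [affLinSize, Fin.sum_univ_one, Int.cast_one, abs_one, Int.cast_add, Int.cast_natCast,
    Nat.cast_ofNat]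
  rw [abs_of_nonneg (by positivity)]
  have : ((N : ℝ) + 1) / N ≤ 2 := by
    rw [div_le_iff₀ hNpos]; linarith
  linarith

/-- The top joint cell of `ψ(n) = n + (N+1)`, `N + 1 = p^{U}` with `N^{1/U} < p`, contains `n = 0`. [folklore] -/
theorem one_le_jointCell_shiftTop {N U p : ℕ} (hp : p.Prime) (hU : U ≠ 0) (hNp : p ^ U = N + 1)
    (hth : (N : ℝ) ^ ((1 : ℝ) / (U : ℕ)) < p) :
    1 ≤ jointCell 1 N U (fun _ : Fin 1 => (⟨fun _ => 1, (N : ℤ) + 1⟩ : AffLinForm 1)) (realBox 1 N) (fun _ => U) := by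
  unfold jointCell
  refine Finset.card_pos.mpr ⟨fun _ => 0, ?_⟩
  rw [Finset.mem_filter]
  refine ⟨?_, ?_, fun _ => ?_⟩
  · simp [latticeBox]
  · refine ⟨fun i => ?_, fun i => ?_⟩ <;> simp [realPoint]
  · have hev : ((⟨fun _ => 1, (N : ℤ) + 1⟩ : AffLinForm 1).eval (fun _ => 0)).toNat = p ^ U := by
      simp only [AffLinForm.eval, mul_zero, Finset.sum_const_zero, zero_add]
      rw [hNp]; rfl
    rw [hev]
    refine ⟨?_, ArithmeticFunction.cardFactors_apply_prime_pow hp⟩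
    rw [Nat.Prime.pow_minFac hp hU]
    exact hth

/-- **The purely relative retyping is false** (so the absolute allowance — or an absolute floor in any two-tier
retyping — is load-bearing): at `t = 1`, `L = 3`, at a scale `N = p^{U(N)} − 1` (`exists_shifted_top_value`), the
shifted form `ψ(n) = n + (N+1)` on `K = [-N, N]` has the top cell `j = U(N)` inhabited (`n = 0 ↦ p^{U(N)}`) while
its model `β_∞ 𝔖 A_{U(N)}(N)/N = 0` (`cell_top_eq_zero`) — a relative allowance then demands `C_j = 0`.
Repair: keep the absolute allowance (as typed), or restrict relative clauses to `j_i ≤ U(N) − 1`, or add a floor.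
[folklore] -/
theorem cellParityLawSaving_false_relative : ¬ (∀ (t L : ℕ), 1 ≤ t → ∃ δ : ℝ, 0 < δ ∧ ∃ N₀ : ℕ, ∀ N : ℕ, N₀ ≤ N →
    ∀ Ψ : Fin t → AffLinForm 1, IsNondegenerateSystem Ψ → affLinSize Ψ N ≤ L →
    ∀ K : Set (Fin 1 → ℝ), Convex ℝ K → K ⊆ realBox 1 N →
    ∃ θ : Finset (Fin t) → ℝ, θ ∅ = 1 ∧ (∀ S, |θ S| ≤ 2) ∧
      ∀ j : Fin t → ℕ, (∀ i, 1 ≤ j i ∧ j i ≤ slowDegree N) →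
        |(jointCell t N (slowDegree N) Ψ K j : ℝ) -
            (∑ S : Finset (Fin t), θ S * ∏ i ∈ S, (-1 : ℝ) ^ (j i + 1)) *
              (archFactor Ψ K * singularProduct Ψ *
                ∏ i, (cell (slowDegree N) N (j i) : ℝ) / N)| ≤
          Real.log N ^ (-δ) *
            |(∑ S : Finset (Fin t), θ S * ∏ i ∈ S, (-1 : ℝ) ^ (j i + 1)) *
              (archFactor Ψ K * singularProduct Ψ *
                ∏ i, (cell (slowDegree N) N (j i) : ℝ) / N)|) := by
  intro h
  obtain ⟨δ, -, N₀, hN₀⟩ := h 1 3 le_rfl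
  obtain ⟨N, hNN₀, hN3, p, hp, hth, hNp⟩ := exists_shifted_top_value N₀
  have hU0 : slowDegree N ≠ 0 := by have := four_le_slowDegree N; omega
  obtain ⟨θ, -, -, hj⟩ := hN₀ N hNN₀ (fun _ : Fin 1 => (⟨fun _ => 1, (N : ℤ) + 1⟩ : AffLinForm 1)) (isNondegenerateSystem_shiftTop N)
    (affLinSize_shiftTop (by omega)) (realBox 1 N) (convex_Icc _ _) subset_rfl
  have h1 := hj (fun _ => slowDegree N) (fun _ => ⟨by omega, le_rfl⟩)
  rw [Fin.prod_univ_one, cell_top_eq_zero N (by omega)] at h1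
  simp only [Nat.cast_zero, zero_div, mul_zero, abs_zero, sub_zero] at h1
  have hC := one_le_jointCell_shiftTop hp hU0 hNp hth
  have hC' : (1 : ℝ) ≤ (jointCell 1 N (slowDegree N) (fun _ : Fin 1 => (⟨fun _ => 1, (N : ℤ) + 1⟩ : AffLinForm 1)) (realBox 1 N)
      (fun _ => slowDegree N) : ℝ) := by exact_mod_cast hC
  rw [abs_of_nonneg (by positivity)] at h1
  linarith

end Summit.Parity.GeneralizedHardyLittlewood.Theorems.CellParityLawSaving.Negative

end
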